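import Summits.HodgeConjecture.HodgeConjecture.Theorems.Q8BireflectionGroupDensityAmbient
import Summits.HodgeConjecture.HodgeConjecture.Theorems.Q8SymplecticPowersTransportRestriction
import HarnessLib

/-!
# Route `Q8SymplecticPowers`, crux K1Q «mechanism-v3» — glue S7(c), part 2: the RESTRICTION CURRENCY
# (BQ-CORE on the variable quaternionic part `Mv = N^⊥` returns to `H²`: every element of the quaternionic-unitary centraliser
# fixing the finite-orbit part `N` lies in the identity component of the Zariski closure of the monodromy group)

Support file for crux K1Q (stmt-HodgeConjecture-24190; `--supports … --as helper`; nothing here closes an item). Prover seat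
`hodge-nonav-19716-p2` (g14), owner of stub S7 `stub_transportHeredityQ` of the registered skeleton «mechanism-v3» (p3 g37). This is the
step «(c) S3 with `V := Mv ⊗ ℂ`, `Γ :=` restricted monodromy ⇒ `Uni|_{Mv} ⊆ (Γ^Zar)°`» of the line card, in the POINT CURRENCY of the
registered stubs S4 (ii)(iii) and S5 (their hypotheses appear below VERBATIM with `H := H²(X_s;ℚ)`, `A := τ_s^*`, `B := j_s^*`,
`Qf := tr ∘ cup`, `Γ := ratMonodromyGroup`, `N`, `Mv`), as ONE algebra theorem over `ℚ`:

* **`mem_glIdentityComponent_of_variablePart`** — `H` finite-dimensional over `ℚ`, `Qf` symmetric non-degenerate, `A⁴ = 1`, `B² = A²`,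
  `BA = A³B`, `A, B` `Qf`-isometries, `Γ ≤ GL(H)` commuting with `A, B` inside `O(Qf)`; `N` the span of the classes with a finite-index
  stabiliser, `Mv := ker(A² + 1) ⊓ N^⊥`; HYPOTHESES (hV) `ker(A² − 1) ≤ N` (finite monodromy on the `τ²`-invariant part — in the family
  this is Deligne 1982 move (F) on a sub-VHS of type (1,1)), (hNQ) `Qf|_N` non-degenerate (Hodge index on the (1,1)-part), (hM) (h_sirr)
  = S4 (ii)(iii), (h_bi) = S5, and Katz's four recognition facts; CONCLUSION: every `g ∈ GL(H)` commuting with `A, B`, `Qf`-isometric,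
  with `g|_N = id` lies in `glIdentityComponent Γ`.

PROOF (all ingredients are tree theorems): `N = Fix(Γ₀)` for one finite-index `Γ₀ ≤ Γ` (`exists_finiteIndex_normal_span_fixed_iff`);
`N`, hence `N^⊥`, is stable under `Γ`, `A`, `B` (`span_fixed_map_mem(_of_comm)`, `orthogonal_map_mem_of_isometry`); (hV) + `N ∩ N^⊥ = 0`
give `N^⊥ = Mv` (for `x ∈ N^⊥`, `x + A²x ∈ ker(A²−1) ∩ N^⊥ ⊆ N ∩ N^⊥`), so `H = N ⊕ Mv` (`isCompl_orthogonal_of_restrict_nondegenerate`)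
and `Qf|_{Mv}` is non-degenerate; the quaternionic relations hold on `Mv`; prover-Ax's `mem_glIdentityComponent_restrict_of_bireflection`
(W := Mv, i := I) puts `g|_{Mv}` in `glIdentityComponent Γ_{Mv}`, which lies in `glIdentityComponent (Γ₀)_{Mv}` (finite index descends,
`le_and_finiteIndex_restrictSubgroup` + Ax's `glIdentityComponent_subset_of_finiteIndex`); `Γ₀` fixes `N` pointwise, so
`mem_glIdentityComponent_of_invariant_isCompl` returns `g ∈ glIdentityComponent Γ₀ ⊆ glIdentityComponent Γ` (`glIdentityComponent_mono`).
HONEST FRAMING: algebra only, conditional exactly on the four Katz named facts (binders of S7 v3); K1Q ∕ HC ∕ HC_AV NOT proved;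
item 24190 OPEN.

## References
* [Katz1990ESDE] N. M. Katz, Exponential Sums and Differential Equations, Ann. of Math. Stud. 124 (1990), Thm. 1.4, Thm. 1.5, Rmk. 1.4.1.
* [SpringerLAG1998] T. A. Springer, Linear Algebraic Groups, 2nd ed., 2.2.1.
* [CarlsonMullerStachPeters2017] J. Carlson, S. Müller-Stach, C. Peters, Period Mappings and Period Domains, 2nd ed., Lemma–Def. 15.3.7.
-/

noncomputable section

set_option linter.dupNamespace false

namespace Summit.HodgeConjecture.HodgeConjecture.Theorems.Q8SymplecticPowersTransportRestrictionCurrency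

open Module Literature.AlgebraicGeometry.Motives Literature.AlgebraicGeometry.HodgeTheory
open Literature.Algebra.Lie Literature.Algebra.Lie.KatzRecognition
open Summit.HodgeConjecture.HodgeConjecture.Theorems.Q8BireflectionGroupDensityAmbient
  (mem_glIdentityComponent_restrict_of_bireflection)
open Summit.HodgeConjecture.HodgeConjecture.Theorems.Q8SymplecticPowersTransportRestriction
open LinearMap (BilinForm)
open scoped TensorProduct

set_option maxHeartbeats 400000 in
/-- **RESTRICTION CURRENCY of S7(c) (BQ-CORE on `Mv = N^⊥` returns to `H²`).** See the module docstring: over `ℚ`, with `Qf` symmetric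
non-degenerate, `A⁴ = 1`, `B² = A²`, `BA = A³B`, `A, B` `Qf`-isometries, `Γ` commuting with `A, B` inside `O(Qf)`, `N` the finite-orbit
span (registered text), `Mv = ker(A²+1) ⊓ N^⊥` (registered text), hypotheses (hV) `ker(A²−1) ≤ N`, (hNQ) `Qf|_N` non-degenerate,
S4 (ii)(iii) and S5 VERBATIM in point currency, and Katz's four facts: every `g ∈ GL(H)` commuting with `A, B`, `Qf`-isometric, equal to
the identity on `N`, lies in `glIdentityComponent Γ`. [cite: Katz1990ESDE, Thm. 1.4, Thm. 1.5, Rmk. 1.4.1]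
[cite: SpringerLAG1998, 2.2.1] -/
theorem mem_glIdentityComponent_of_variablePart
    (h14 : Katz1990_thm14_gabber_of_ne) (h14' : Katz1990_thm14_gabber_dim8)
    (h15 : Katz1990_thm15_pseudoreflection) (h141 : Katz1990_rmk141_nonsimple)
    {H : Type} [AddCommGroup H] [Module ℚ H] [FiniteDimensional ℚ H]
    {Qf : BilinForm ℚ H} (hQs : ∀ x y, Qf x y = Qf y x) (hQn : Qf.Nondegenerate)
    {A B : H →ₗ[ℚ] H} (hA4 : A ^ 4 = 1) (hB2 : B ^ 2 = A ^ 2) (hBA : B * A = A ^ 3 * B)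
    (hAQ : ∀ x y, Qf (A x) (A y) = Qf x y) (hBQ : ∀ x y, Qf (B x) (B y) = Qf x y)
    {Γ : Subgroup (H ≃ₗ[ℚ] H)} (hΓA : ∀ γ ∈ Γ, ∀ x, γ (A x) = A (γ x)) (hΓB : ∀ γ ∈ Γ, ∀ x, γ (B x) = B (γ x))
    (hΓQ : ∀ γ ∈ Γ, ∀ x y, Qf (γ x) (γ y) = Qf x y)
    {N : Submodule ℚ H}
    (hN : N = Submodule.span ℚ {x : H | ∃ Γ' : Subgroup (H ≃ₗ[ℚ] H), Γ' ≤ Γ ∧ (Γ'.subgroupOf Γ).FiniteIndex ∧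
      ∀ γ ∈ Γ', γ x = x})
    (hV : Module.End.eigenspace (A ^ 2) 1 ≤ N) (hNQ : ∀ x ∈ N, (∀ y ∈ N, Qf x y = 0) → x = 0)
    {Mv : Submodule ℚ H} (hMv : Mv = Module.End.eigenspace (A ^ 2) (-1) ⊓ Qf.orthogonal N)
    (hM : 6 ≤ finrank ℂ ↥(Mv.baseChange ℂ ⊓ Module.End.eigenspace (A.baseChange ℂ) Complex.I))
    (h_sirr : ∀ Γ' : Subgroup (H ≃ₗ[ℚ] H), Γ' ≤ Γ → (Γ'.subgroupOf Γ).FiniteIndex →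
      ∀ F : Submodule ℂ (ℂ ⊗[ℚ] H), F ≤ Mv.baseChange ℂ ⊓ Module.End.eigenspace (A.baseChange ℂ) Complex.I →
      (∀ γ ∈ Γ', ∀ x ∈ F, (γ.toLinearMap.baseChange ℂ) x ∈ F) →
      F = ⊥ ∨ F = Mv.baseChange ℂ ⊓ Module.End.eigenspace (A.baseChange ℂ) Complex.I)
    (h_bi : ∃ γ ∈ Γ, ∃ ℓp ℓm : ℂ ⊗[ℚ] H, ℓp ∈ Mv.baseChange ℂ ∧ ℓm ∈ Mv.baseChange ℂ ∧
      A.baseChange ℂ ℓp = Complex.I • ℓp ∧ A.baseChange ℂ ℓm = Complex.I • ℓm ∧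
      (Qf.baseChange ℂ) ℓp (B.baseChange ℂ ℓm) ≠ 0 ∧ (γ.toLinearMap.baseChange ℂ) ℓp = Complex.I • ℓp ∧
      (γ.toLinearMap.baseChange ℂ) ℓm = (-Complex.I) • ℓm ∧
      ∀ x ∈ Mv.baseChange ℂ, A.baseChange ℂ x = Complex.I • x → (Qf.baseChange ℂ) x (B.baseChange ℂ ℓp) = 0 →
        (Qf.baseChange ℂ) x (B.baseChange ℂ ℓm) = 0 → (γ.toLinearMap.baseChange ℂ) x = x)
    {g : H ≃ₗ[ℚ] H} (hgA : ∀ x, g (A x) = A (g x)) (hgB : ∀ x, g (B x) = B (g x))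
    (hgQ : ∀ x y, Qf (g x) (g y) = Qf x y) (hgN : ∀ x ∈ N, g x = x) :
    g ∈ glIdentityComponent Γ := by
  classical
  -- ### §0 identities in `End H`
  have hA2sq : A ^ 2 * A ^ 2 = 1 := by rw [← pow_add]; exact hA4
  have hB4 : B ^ 4 = 1 := by
    calc B ^ 4 = B ^ 2 * B ^ 2 := by rw [← pow_add]
      _ = 1 := by rw [hB2, hA2sq]
  have hBA2 : B * A ^ 2 = A ^ 2 * B := by
    calc B * A ^ 2 = B * A * A := by rw [pow_two, mul_assoc]
      _ = A ^ 3 * B * A := by rw [hBA]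
      _ = A ^ 3 * (B * A) := by rw [mul_assoc]
      _ = A ^ 3 * (A ^ 3 * B) := by rw [hBA]
      _ = A ^ 6 * B := by rw [← mul_assoc, ← pow_add]
      _ = A ^ 2 * B := by rw [show (6 : ℕ) = 2 + 4 from rfl, pow_add, hA4, mul_one]
  have hA2x : ∀ x, (A ^ 2) x = A (A x) := fun x => by rw [pow_two]; rfl
  have hB2x : ∀ x, (B ^ 2) x = B (B x) := fun x => by rw [pow_two]; rfl
  have hA2A : ∀ x, A ((A ^ 2) x) = (A ^ 2) (A x) := fun x => by
    change (A * A ^ 2) x = (A ^ 2 * A) x; rw [← pow_succ', ← pow_succ]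
  have hA2B : ∀ x, B ((A ^ 2) x) = (A ^ 2) (B x) := fun x => by
    change (B * A ^ 2) x = (A ^ 2 * B) x; rw [hBA2]
  have hA2Γ : ∀ γ ∈ Γ, ∀ x, γ ((A ^ 2) x) = (A ^ 2) (γ x) := fun γ hγ x => by
    rw [hA2x, hA2x, hΓA γ hγ, hΓA γ hγ]
  have hA2g : ∀ x, g ((A ^ 2) x) = (A ^ 2) (g x) := fun x => by rw [hA2x, hA2x, hgA, hgA]
  have hA2Q : ∀ x y, Qf ((A ^ 2) x) ((A ^ 2) y) = Qf x y := fun x y => by rw [hA2x, hA2x, hAQ, hAQ]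
  -- `A`, `A²`, `B` as automorphisms
  obtain ⟨Ae, hAe, hAe'⟩ := exists_linearEquiv_of_mul_eq_one (f := A) (g := A ^ 3)
    (by rw [← pow_succ']; exact hA4) (by rw [← pow_succ]; exact hA4)
  obtain ⟨A2e, hA2e, hA2e'⟩ := exists_linearEquiv_of_mul_eq_one (f := A ^ 2) (g := A ^ 2) hA2sq hA2sq
  obtain ⟨Be, hBe, hBe'⟩ := exists_linearEquiv_of_mul_eq_one (f := B) (g := B ^ 3)
    (by rw [← pow_succ']; exact hB4) (by rw [← pow_succ]; exact hB4)
  -- ### §1 `N = Fix(Γ₀)`; stability of `N`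
  obtain ⟨Γ₀, hΓ₀le, hΓ₀fi, -, hΓ₀fix⟩ := exists_finiteIndex_normal_span_fixed_iff Γ
  have hNfix : ∀ x, x ∈ N ↔ ∀ γ ∈ Γ₀, γ x = x := fun x => by rw [hN]; exact hΓ₀fix x
  have hΓN : ∀ γ ∈ Γ, ∀ x ∈ N, γ x ∈ N := fun γ hγ x hx => by
    rw [hN] at hx ⊢; exact span_fixed_map_mem Γ hγ hx
  have hAN : ∀ x ∈ N, A x ∈ N := fun x hx => by
    rw [hN] at hx ⊢; exact span_fixed_map_mem_of_comm Γ hΓA hx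
  have hBN : ∀ x ∈ N, B x ∈ N := fun x hx => by
    rw [hN] at hx ⊢; exact span_fixed_map_mem_of_comm Γ hΓB hx
  have hApowN : ∀ (k : ℕ), ∀ x ∈ N, (A ^ k) x ∈ N := by
    intro k
    induction k with
    | zero => intro x hx; simpa using hx
    | succ k ih => intro x hx; rw [pow_succ', Module.End.mul_apply]; exact hAN _ (ih x hx)
  have hBpowN : ∀ (k : ℕ), ∀ x ∈ N, (B ^ k) x ∈ N := by
    intro k
    induction k with
    | zero => intro x hx; simpa using hx
    | succ k ih => intro x hx; rw [pow_succ', Module.End.mul_apply]; exact hBN _ (ih x hx)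
  have hgsymmN : ∀ x ∈ N, g.symm x ∈ N := fun x hx => by
    have h := hgN x hx
    rw [← h, LinearEquiv.symm_apply_apply]; exact hx
  -- ### §2 `N^⊥` and its stability
  have hΓNp : ∀ γ ∈ Γ, ∀ x ∈ Qf.orthogonal N, γ x ∈ Qf.orthogonal N := fun γ hγ x hx =>
    orthogonal_map_mem_of_isometry (hΓQ γ hγ) (fun y hy => hΓN γ⁻¹ (Γ.inv_mem hγ) y hy) hx
  have hANp : ∀ x ∈ Qf.orthogonal N, A x ∈ Qf.orthogonal N := fun x hx => by
    have h := orthogonal_map_mem_of_isometry (γ := Ae) (fun x y => by rw [hAe, hAe]; exact hAQ x y)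
      (fun y hy => by rw [hAe']; exact hApowN 3 y hy) hx
    rwa [hAe] at h
  have hA2Np : ∀ x ∈ Qf.orthogonal N, (A ^ 2) x ∈ Qf.orthogonal N := fun x hx =>
    by rw [hA2x]; exact hANp _ (hANp x hx)
  have hBNp : ∀ x ∈ Qf.orthogonal N, B x ∈ Qf.orthogonal N := fun x hx => by
    have h := orthogonal_map_mem_of_isometry (γ := Be) (fun x y => by rw [hBe, hBe]; exact hBQ x y)
      (fun y hy => by rw [hBe']; exact hBpowN 3 y hy) hx
    rwa [hBe] at h
  have hgNp : ∀ x ∈ Qf.orthogonal N, g x ∈ Qf.orthogonal N := fun x hx =>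
    orthogonal_map_mem_of_isometry hgQ hgsymmN hx
  -- `N ∩ N^⊥ = 0`
  have hNNp : ∀ x ∈ N, x ∈ Qf.orthogonal N → x = 0 := fun x hxN hxNp =>
    hNQ x hxN fun y hy => by
      rw [LinearMap.BilinForm.mem_orthogonal_iff] at hxNp
      rw [hQs]; exact hxNp y hy
  -- ### §3 `N^⊥ = Mv`, `H = N ⊕ Mv`, `Qf|_{Mv}` non-degenerate
  have hMv_V : ∀ x ∈ Mv, (A ^ 2) x = -x := fun x hx => by
    rw [hMv] at hx
    have h := Module.End.mem_eigenspace_iff.1 hx.1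
    rwa [neg_one_smul] at h
  have hMv_Np : ∀ x ∈ Mv, x ∈ Qf.orthogonal N := fun x hx => by rw [hMv] at hx; exact hx.2
  have hNp_Mv : ∀ x ∈ Qf.orthogonal N, x ∈ Mv := fun x hx => by
    rw [hMv]
    refine Submodule.mem_inf.2 ⟨?_, hx⟩
    have hy : x + (A ^ 2) x ∈ Module.End.eigenspace (A ^ 2) 1 := by
      rw [Module.End.mem_eigenspace_iff, one_smul, map_add, ← Module.End.mul_apply, hA2sq, Module.End.one_apply,
        add_comm]
    have hy0 : x + (A ^ 2) x = 0 := hNNp _ (hV hy) ((Qf.orthogonal N).add_mem hx (hA2Np x hx))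
    rw [Module.End.mem_eigenspace_iff, neg_one_smul]
    exact eq_neg_of_add_eq_zero_right hy0
  have hNp_eq : Qf.orthogonal N = Mv := le_antisymm hNp_Mv hMv_Np
  have hrefl : Qf.IsRefl := fun x y h => by rw [hQs]; exact h
  have hres : (Qf.restrict N).Nondegenerate := by
    refine ⟨fun x hx => Subtype.ext (hNQ x x.2 fun y hy => hx ⟨y, hy⟩), fun y hy => Subtype.ext (hNQ y y.2 fun x hx => ?_)⟩
    rw [hQs]; exact hy ⟨x, hx⟩
  have hcompl : IsCompl N Mv := by
    rw [← hNp_eq]; exact LinearMap.BilinForm.isCompl_orthogonal_of_restrict_nondegenerate hrefl hres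
  have hQW : ∀ x ∈ Mv, (∀ y ∈ Mv, Qf x y = 0) → x = 0 := by
    intro x hx h
    refine hQn.1 x fun y => ?_
    have hy : y ∈ N ⊔ Mv := by rw [hcompl.sup_eq_top]; exact Submodule.mem_top
    obtain ⟨n, hn, m, hm, rfl⟩ := Submodule.mem_sup.1 hy
    have h1 : Qf x n = 0 := by
      rw [hQs]; exact (LinearMap.BilinForm.mem_orthogonal_iff.1 (hMv_Np x hx)) n hn
    rw [map_add, h1, h m hm, zero_add]
  -- ### §4 the quaternionic data on `Mv`
  have hAMv : ∀ x ∈ Mv, A x ∈ Mv := fun x hx => by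
    rw [hMv] at hx ⊢
    exact ⟨apply_mem_eigenspace_of_comm (f := A ^ 2) (g := A) hA2A hx.1, hANp x hx.2⟩
  have hBMv : ∀ x ∈ Mv, B x ∈ Mv := fun x hx => by
    rw [hMv] at hx ⊢
    exact ⟨apply_mem_eigenspace_of_comm (f := A ^ 2) (g := B) hA2B hx.1, hBNp x hx.2⟩
  have hΓMv : ∀ γ ∈ Γ, ∀ x ∈ Mv, γ x ∈ Mv := fun γ hγ x hx => by
    rw [hMv] at hx ⊢
    exact ⟨apply_mem_eigenspace_of_comm (f := A ^ 2) (g := (γ : H →ₗ[ℚ] H)) (hA2Γ γ hγ) hx.1, hΓNp γ hγ x hx.2⟩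
  have hgMv : ∀ x ∈ Mv, g x ∈ Mv := fun x hx => by
    rw [hMv] at hx ⊢
    exact ⟨apply_mem_eigenspace_of_comm (f := A ^ 2) (g := (g : H →ₗ[ℚ] H)) hA2g hx.1, hgNp x hx.2⟩
  have hgMv' : ∀ x ∈ Mv, g.symm x ∈ Mv := fun x hx => by
    -- `g.symm` commutes with `A²`, is `Qf`-isometric and `g` preserves `N`
    have hA2g' : ∀ x, g.symm ((A ^ 2) x) = (A ^ 2) (g.symm x) := fun x =>
      g.injective (by rw [LinearEquiv.apply_symm_apply, hA2g, LinearEquiv.apply_symm_apply])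
    have hgQ' : ∀ x y, Qf (g.symm x) (g.symm y) = Qf x y := fun x y => by
      conv_rhs => rw [← g.apply_symm_apply x, ← g.apply_symm_apply y]
      exact (hgQ _ _).symm
    rw [hMv] at hx ⊢
    refine ⟨apply_mem_eigenspace_of_comm (f := A ^ 2) (g := (g.symm : H →ₗ[ℚ] H)) hA2g' hx.1,
      orthogonal_map_mem_of_isometry (γ := g.symm) hgQ' (fun y hy => ?_) hx.2⟩
    rw [LinearEquiv.symm_symm, hgN y hy]; exact hy
  have haa : ∀ x ∈ Mv, A (A x) = -x := fun x hx => by rw [← hA2x]; exact hMv_V x hx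
  have hbb : ∀ x ∈ Mv, B (B x) = -x := fun x hx => by rw [← hB2x, hB2]; exact hMv_V x hx
  have hab : ∀ x ∈ Mv, A (B x) = -B (A x) := fun x hx => by
    have h : B (A x) = -A (B x) := by
      change (B * A) x = -A (B x)
      rw [hBA, pow_succ', Module.End.mul_apply, Module.End.mul_apply, hMv_V _ (hBMv x hx), map_neg]
    rw [h, neg_neg]
  -- ### §5 restriction groups, the restricted `g`, BQ-CORE on `Mv`
  obtain ⟨ΓW, hΓW'⟩ := exists_restrictSubgroup hΓMv
  let gW : Mv ≃ₗ[ℚ] Mv := LinearEquiv.ofLinear ((g : H →ₗ[ℚ] H).restrict hgMv) ((g.symm : H →ₗ[ℚ] H).restrict hgMv')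
    (LinearMap.ext fun x => Subtype.ext (by simp)) (LinearMap.ext fun x => Subtype.ext (by simp))
  have hgW : ∀ x : Mv, ((gW x : Mv) : H) = g x := fun x => rfl
  have hgW_mem : gW ∈ glIdentityComponent ΓW :=
    mem_glIdentityComponent_restrict_of_bireflection h14 h14' h15 h141 hQs Mv hAMv hBMv hQW haa hbb hab
      (fun x _ y _ => hAQ x y) (fun x _ y _ => hBQ x y) Complex.I_mul_I hM hΓMv (fun γ hγ x _ => hΓA γ hγ x)
      (fun γ hγ x _ => hΓB γ hγ x) (fun γ hγ x _ y _ => hΓQ γ hγ x y) h_sirr h_bi hΓW' (fun x _ => hgA x)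
      (fun x _ => hgB x) (fun x _ y _ => hgQ x y) hgW
  -- finite-index descent to `Γ₀`
  obtain ⟨ΓW₀, hΓW₀'⟩ := exists_restrictSubgroup (Γ := Γ₀) (W := Mv) fun γ hγ => hΓMv γ (hΓ₀le hγ)
  obtain ⟨hle₀, hfi₀⟩ := le_and_finiteIndex_restrictSubgroup hΓ₀le hΓ₀fi hΓMv hΓW' hΓW₀'
  have hgW₀ : gW ∈ glIdentityComponent ΓW₀ :=
    Q8BireflectionGroupDensityAmbient.glIdentityComponent_subset_of_finiteIndex hle₀ hfi₀ hgW_mem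
  -- ### §6 back to `H = N ⊕ Mv`
  have hg₀ : g ∈ glIdentityComponent Γ₀ :=
    mem_glIdentityComponent_of_invariant_isCompl N Mv hcompl (Θ := Γ₀) (fun θ hθ x hx => (hNfix x).1 hx θ hθ)
      (fun θ hθ x hx => hΓMv θ (hΓ₀le hθ) x hx) hΓW₀' hgN (gQ := gW) hgW hgW₀
  exact glIdentityComponent_mono hΓ₀le hg₀

end Summit.HodgeConjecture.HodgeConjecture.Theorems.Q8SymplecticPowersTransportRestrictionCurrency

end
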